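import Literature.Analysis.FluidPDE.TaoAveragedRotDil
import Literature.Analysis.FluidPDE.TaoAveragedBetaForm
import Literature.Analysis.FluidPDE.TaoMultiplierToolkit
import HarnessLib

/-!
# Tao 2016, §3.3–§3.4: weighted Euler forms — `B_{η,ρ}`, `B_{η,ρ,n}` as symbol-weighted integrals,
the scaling laws, frequency truncation

T. Tao, *Finite time blowup for an averaged three-dimensional Navier–Stokes equation*,
J. Amer. Math. Soc. **29** (2016), 601–674 = arXiv:1402.0290v3 (held as `paper:arxiv-1402.0290`),
§3.3–§3.4 pp. 16–17. The forms `B_η`, `B_{η,ρ}`, `B_{η,ρ,n}` of the tree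
(`TaoAveragedCascadeReduction.lean`) are all of the shape
`∫_{ξ₁+ξ₂+ξ₃=0} W(ξ₁,ξ₂) Λ_{ξ₁,ξ₂,ξ₃}(û(ξ₁), v̂(ξ₂), ŵ(ξ₃))` for a real weight `W`. This support file
for the discharge of `cascade_of_singleScale` (`TaoAveragedCascadeSteps.lean`, §3.4) isolates that
shape as `weightedForm W` and proves the manipulations §3.4 performs on it:

* `weightedForm_congr_ae`, `weightedForm_congr_on` — the form only sees the Fourier transforms,
  and only where the weight is non-zero (the mechanism behind "vanishing otherwise … thanks to
  the support properties of `m_{i,ω,n}`, `η` and `ρ`");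
* `weightedForm_smul₁` — homogeneity in the first field;
* `weightedForm_dil` — **the scaling law**: the `W`-form of `(Dil_c u, Dil_c v, Dil_c w)` equals
  `c^{5/2}` times the `W(c ·)`-form of `(u, v, w)` ("by using the change of variables
  `ξ̃ := ξ/(1+ε₀)ⁿ`"), whence `betaRhoScaleForm_eq_dil`:
  **`⟨B_{η,ρ,n}(u,v), w⟩ = ⟨B_{η,ρ,0}(Dil u, Dil v), Dil w⟩`, `Dil = Dil_{(1+ε₀)^{-n}}`** (§3.4, the
  first displayed scaling law);
* `enorm_weightedForm_le`, `weightedForm_tsum` — the crude bound and the summation of weights under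
  absolute convergence (for `B_{η,ρ} = -πi Σₙ (1+ε₀)^{5n/2} B_{η,ρ,n}`, `betaRhoForm_eq_tsum`);
* `pairing_conjL2_dil_eq`, `cascadeTerm_eq_singleScaleForm_dil` —
  **`⟨C_n(u,v), w⟩ = ⟨C₀(Dil u, Dil v), Dil w⟩`** (§3.4, the second displayed scaling law, (3.8));
* `pairing_fourierMultiplier_conjL2`, `singleScaleForm_fourierMultiplier` — `C₀` does not see
  Fourier projections equal to `1` on the balls `B(ξⱼ⁰, ε₀³)` carrying `ψ̂ⱼ` ("from the
  definition of `C₀` and the support hypotheses on `ψ₁, ψ₂, ψ₃` we may smoothly localise each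
  `m_{j,ω}`").

## References

* T. Tao, J. Amer. Math. Soc. 29 (2016), 601–674, arXiv:1402.0290v3, §3.3–§3.4 pp. 16–17, (3.8).
  Key `Tao2016AveragedNS`.
-/

noncomputable section

open MeasureTheory Set Filter FourierTransform
open scoped ENNReal NNReal SchwartzMap ComplexConjugate

namespace Literature.Analysis.FluidPDE.Tao2016

/-- Local notation for physical / frequency space `ℝ³`. -/
local notation "ℝ³" => EuclideanSpace ℝ (Fin 3)
/-- Local notation for the complexified range `ℂ³`. -/
local notation "ℂ³" => EuclideanSpace ℂ (Fin 3)

/-! ### Homogeneity of `Λ` in the frequencies -/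

/-- `Λ_{cξ₁,cξ₂,cξ₃} = c Λ_{ξ₁,ξ₂,ξ₃}`: the symbol (1.4) is homogeneous of degree one in the
frequencies (`c` real). [cite: Tao2016AveragedNS, (1.4)] -/
theorem Λ_smul_freq (a : ℝ) (ξ₁ ξ₂ : ℝ³) (X₁ X₂ X₃ : ℂ³) :
    Λ (a • ξ₁) (a • ξ₂) X₁ X₂ X₃ = (a : ℂ) * Λ ξ₁ ξ₂ X₁ X₂ X₃ := by
  simp only [Λ, cdot, PiLp.smul_apply, smul_eq_mul, Fin.sum_univ_three,
    FunctionSpaces.EuclideanSpace.complexify_apply, Complex.ofReal_mul]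
  ring

/-! ### Weighted Euler forms -/

/-- The **weighted Euler form** with real weight `W` on frequency pairs:
`∫∫ W(ξ₁,ξ₂) Λ_{ξ₁,ξ₂,ξ₃}(û(ξ₁), v̂(ξ₂), ŵ(ξ₃)) dξ₁dξ₂`, `ξ₃ = -ξ₁-ξ₂` — the common shape of
`B_η`, `B_{η,ρ}`, `B_{η,ρ,n}` (§3.3–§3.4) and, with `W ≡ 1` and the factor `-πi`, of `B` (1.3)
(`eulerIntegrand u v w (ξ₁,ξ₂) = Λ(û(ξ₁), v̂(ξ₂), ŵ(-ξ₁-ξ₂))`). Bochner junk `0`. [cite: Tao2016AveragedNS, §3.3–3.4 pp. 16–17] -/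
def weightedForm (W : ℝ³ × ℝ³ → ℝ) (U V X : L2C) : ℂ :=
  ∫ p : ℝ³ × ℝ³, ((W p : ℝ) : ℂ) * eulerIntegrand U V X p

/-- The weight of `B_{η,ρ,n}` (§3.4): `φ(|(1+ε₀)^{-n}ξ₁ - ξ₁⁰|/ε₀²) η(|ξ₁|,|ξ₂|,|ξ₃|)`. [cite: Tao2016AveragedNS, §3.4 p. 16] -/
def scaleWeight (ε₀ : ℝ) (n : ℤ) (p : ℝ³ × ℝ³) : ℝ :=
  freqCutoff (‖((1 + ε₀) ^ (-n) : ℝ) • p.1 - xi0 0‖ / ε₀ ^ 2) * eta ε₀ ‖p.1‖ ‖p.2‖ ‖-p.1 - p.2‖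

/-- The weight of `B_{η,ρ}` (§3.3): `ρ(ξ₁) η(|ξ₁|,|ξ₂|,|ξ₃|)`. [cite: Tao2016AveragedNS, §3.3 p. 16] -/
def rhoWeight (ε₀ : ℝ) (p : ℝ³ × ℝ³) : ℝ :=
  rho ε₀ p.1 * eta ε₀ ‖p.1‖ ‖p.2‖ ‖-p.1 - p.2‖

/-- `B_{η,ρ,n} = (1+ε₀)^{-5n/2} × (scaleWeight-form)`. [cite: Tao2016AveragedNS, §3.4 p. 16] -/
theorem betaRhoScaleForm_eq_weightedForm (ε₀ : ℝ) (n : ℤ) (U V X : L2C) :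
    betaRhoScaleForm ε₀ n U V X =
      (((1 + ε₀) ^ (-(5 : ℝ) * (n : ℝ) / 2) : ℝ) : ℂ) * weightedForm (scaleWeight ε₀ n) U V X :=
  rfl

/-- `B_{η,ρ,0}` is the `scaleWeight 0`-form. [cite: Tao2016AveragedNS, §3.4 (3.9)] -/
theorem betaRhoZeroForm_eq_weightedForm (ε₀ : ℝ) (U V X : L2C) :
    betaRhoZeroForm ε₀ U V X = weightedForm (scaleWeight ε₀ 0) U V X := by
  rw [betaRhoZeroForm, betaRhoScaleForm_eq_weightedForm]
  simp

/-- `B_{η,ρ} = -πi × (rhoWeight-form)`. [cite: Tao2016AveragedNS, §3.3 p. 16] -/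
theorem betaRhoForm_eq_weightedForm (ε₀ : ℝ) (U V X : L2C) :
    betaRhoForm ε₀ U V X = -(Real.pi * Complex.I) * weightedForm (rhoWeight ε₀) U V X :=
  rfl

/-- `ρ η = Σₙ (scale weights)`, pointwise (the definition of `ρ` as a sum over scales). [cite: Tao2016AveragedNS, §3.3–3.4 p. 16] -/
theorem rhoWeight_eq_tsum (ε₀ : ℝ) (p : ℝ³ × ℝ³) : rhoWeight ε₀ p = ∑' n : ℤ, scaleWeight ε₀ n p := by
  unfold rhoWeight rho scaleWeight
  rw [tsum_mul_right]

/-! ### The form only sees the Fourier transforms, on the support of the weight -/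

/-- The weighted form depends on the fields only through (the a.e. class of) their Fourier
transforms. [folklore] -/
theorem weightedForm_congr_ae (W : ℝ³ × ℝ³ → ℝ) {U U' V V' X X' : L2C}
    (hU : fourierFn U =ᵐ[volume] fourierFn U') (hV : fourierFn V =ᵐ[volume] fourierFn V')
    (hX : fourierFn X =ᵐ[volume] fourierFn X') :
    weightedForm W U V X = weightedForm W U' V' X' := by
  unfold weightedForm eulerIntegrand
  refine integral_congr_ae ?_
  filter_upwards [ae_prod_of_ae₁ hU, ae_prod_of_ae₂ hV, ae_prod_of_ae₃ hX] with p h1 h2 h3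
  rw [h1, h2, h3]

/-- The weighted form as the integral of explicit representatives of the three Fourier
transforms. [folklore] -/
theorem weightedForm_eq_integral_of_ae_eq (W : ℝ³ × ℝ³ → ℝ) {U V X : L2C} {F G H : ℝ³ → ℂ³}
    (hU : fourierFn U =ᵐ[volume] F) (hV : fourierFn V =ᵐ[volume] G) (hX : fourierFn X =ᵐ[volume] H) :
    weightedForm W U V X = ∫ p : ℝ³ × ℝ³, ((W p : ℝ) : ℂ) * Λ p.1 p.2 (F p.1) (G p.2) (H (-p.1 - p.2)) := by
  unfold weightedForm eulerIntegrand
  refine integral_congr_ae ?_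
  filter_upwards [ae_prod_of_ae₁ hU, ae_prod_of_ae₂ hV, ae_prod_of_ae₃ hX] with p h1 h2 h3
  rw [h1, h2, h3]

/-- **Support localisation**: if the weight forces `ξ₁ ∈ Z₁`, `ξ₂ ∈ Z₂`, `ξ₃ ∈ Z₃`, then the form
only sees the Fourier transforms on these sets (the mechanism of §3.4: cross terms vanish "thanks
to the support properties of `m_{i,ω,n}`, `η` and `ρ`"). [cite: Tao2016AveragedNS, §3.4 p. 17] -/
theorem weightedForm_congr_on {W : ℝ³ × ℝ³ → ℝ} {Z₁ Z₂ Z₃ : Set ℝ³}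
    (hW : ∀ p, W p ≠ 0 → p.1 ∈ Z₁ ∧ p.2 ∈ Z₂ ∧ -p.1 - p.2 ∈ Z₃) {U U' V V' X X' : L2C}
    (hU : ∀ᵐ ξ ∂(volume : Measure ℝ³), ξ ∈ Z₁ → fourierFn U ξ = fourierFn U' ξ)
    (hV : ∀ᵐ ξ ∂(volume : Measure ℝ³), ξ ∈ Z₂ → fourierFn V ξ = fourierFn V' ξ)
    (hX : ∀ᵐ ξ ∂(volume : Measure ℝ³), ξ ∈ Z₃ → fourierFn X ξ = fourierFn X' ξ) :
    weightedForm W U V X = weightedForm W U' V' X' := by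
  unfold weightedForm eulerIntegrand
  refine integral_congr_ae ?_
  filter_upwards [ae_prod_of_ae₁ hU, ae_prod_of_ae₂ hV, ae_prod_of_ae₃ hX] with p h1 h2 h3
  by_cases hp : W p = 0
  · simp [hp]
  · obtain ⟨hz1, hz2, hz3⟩ := hW p hp
    rw [h1 hz1, h2 hz2, h3 hz3]

/-- Homogeneity in the first field: the `W`-form of `(aU, V, X)` is `a` times that of `(U, V, X)`
(no convergence needed). [folklore] -/
theorem weightedForm_smul₁ (W : ℝ³ × ℝ³ → ℝ) (a : ℂ) (U V X : L2C) :
    weightedForm W (a • U) V X = a * weightedForm W U V X := by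
  unfold weightedForm
  rw [← integral_const_mul]
  refine integral_congr_ae ?_
  filter_upwards [ae_prod_of_ae₁ (fourierFn_smul a U)] with p hp
  simp only [eulerIntegrand, hp, Λ_smul₁]
  ring

/-- **The crude bound** `|W-form(U,V,X)| ≤ ∫∫ |W| |Λ(Û,V̂,X̂)|`. [folklore] -/
theorem enorm_weightedForm_le (W : ℝ³ × ℝ³ → ℝ) (U V X : L2C) :
    ‖weightedForm W U V X‖ₑ ≤ ∫⁻ p : ℝ³ × ℝ³, ‖W p‖ₑ * ‖eulerIntegrand U V X p‖ₑ := by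
  refine (enorm_integral_le_lintegral_enorm _).trans (lintegral_mono fun p => ?_)
  rw [enorm_mul, enorm_eq_nnnorm ((W p : ℝ) : ℂ), Complex.nnnorm_real, ← enorm_eq_nnnorm]

/-! ### The scaling law (§3.4) -/

/-- `dim(ℝ³ × ℝ³) = 6`. [folklore] -/
theorem finrank_prod_euclidean_three : Module.finrank ℝ (ℝ³ × ℝ³) = 6 := by
  rw [Module.finrank_prod, finrank_euclideanSpace, Fintype.card_fin]

/-- The Jacobian bookkeeping of the scaling law: `c⁶ · (c^{-3/2})³ · c = c^{5/2}` (`c > 0`). [folklore] -/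
theorem scaling_const_eq {c : ℝ} (hc : 0 < c) :
    c ^ 6 * (c⁻¹ ^ (3 / 2 : ℝ)) ^ 3 * c = c ^ (5 / 2 : ℝ) := by
  have h1 : c⁻¹ ^ (3 / 2 : ℝ) = (c ^ (3 / 2 : ℝ))⁻¹ := Real.inv_rpow hc.le _
  have h2 : (c ^ (3 / 2 : ℝ)) ^ 3 = c ^ (9 / 2 : ℝ) := by
    rw [← Real.rpow_natCast, ← Real.rpow_mul hc.le]
    norm_num
  have h3 : c ^ 6 * c = c ^ (7 : ℝ) := by
    rw [← pow_succ, ← Real.rpow_natCast]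
    norm_num
  rw [mul_right_comm, h3, h1, inv_pow, h2, ← Real.rpow_neg hc.le, ← Real.rpow_add hc]
  norm_num

/-- **The scaling law for weighted forms** (Tao 2016, §3.4: "Observe (by using the change of
variables `ξ̃ := ξ/(1+ε₀)ⁿ`) that we have the scaling laws …"): for `c > 0`, the `W`-form of
`(Dil_c u, Dil_c v, Dil_c w)` is `c^{5/2}` times the `W(c ·)`-form of `(u, v, w)`
(`\widehat{Dil_c u}(ξ) = c^{-3/2} û(ξ/c)`, `dξ₁dξ₂ ↦ c⁶ dξ̃₁dξ̃₂`, and `Λ` is homogeneous of degree one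
in the frequencies). [cite: Tao2016AveragedNS, §3.4 p. 16] -/
theorem weightedForm_dil (W : ℝ³ × ℝ³ → ℝ) {c : ℝ} (hc : 0 < c) (U V X : L2C) :
    weightedForm W (dil c U) (dil c V) (dil c X) =
      (((c ^ (5 / 2 : ℝ)) : ℝ) : ℂ) * weightedForm (fun p => W (c • p)) U V X := by
  -- Step 1: the Fourier side of the dilated fields
  have hU := fourierFn_dil U hc
  have hV := fourierFn_dil V hc
  have hX := fourierFn_dil X hc
  set k : ℂ := (((c⁻¹ ^ (3 / 2 : ℝ)) : ℝ) : ℂ) with hk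
  rw [weightedForm_eq_integral_of_ae_eq W hU hV hX]
  -- Step 2: pull out the scalars and recognise a rescaled integrand
  set F : ℝ³ × ℝ³ → ℂ := fun p' => ((W (c • p') : ℝ) : ℂ) * (k * k * k) *
    Λ (c • p'.1) (c • p'.2) (fourierFn U p'.1) (fourierFn V p'.2) (fourierFn X (-p'.1 - p'.2)) with hF
  have hfF : ∀ p : ℝ³ × ℝ³, ((W p : ℝ) : ℂ) *
      Λ p.1 p.2 (k • fourierFn U (c⁻¹ • p.1)) (k • fourierFn V (c⁻¹ • p.2))
        (k • fourierFn X (c⁻¹ • (-p.1 - p.2))) = F (c⁻¹ • p) := by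
    intro p
    simp only [hF, Prod.smul_fst, Prod.smul_snd, smul_inv_smul₀ hc.ne', Λ_smul₁, Λ_smul₂, Λ_smul₃,
      smul_sub, smul_neg]
    ring
  simp_rw [hfF]
  -- Step 3: change variables `p = c p'` on `ℝ³ × ℝ³` (dimension 6)
  have hcv := Measure.integral_comp_inv_smul_of_nonneg
    ((volume : Measure ℝ³).prod (volume : Measure ℝ³)) F hc.le
  rw [finrank_prod_euclidean_three] at hcv
  rw [Measure.volume_eq_prod, hcv, Complex.real_smul]
  -- Step 4: homogeneity of `Λ` in the frequencies
  have hF' : ∀ p' : ℝ³ × ℝ³, F p' = (k * k * k * (c : ℂ)) *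
      (((W (c • p') : ℝ) : ℂ) * eulerIntegrand U V X p') := by
    intro p'
    simp only [hF, eulerIntegrand, Λ_smul_freq]
    ring
  simp_rw [hF']
  rw [integral_const_mul, weightedForm, Measure.volume_eq_prod, ← mul_assoc]
  congr 1
  rw [hk]
  push_cast
  rw [← scaling_const_eq hc]
  push_cast
  ring

/-- `η` is scale invariant: `η(cN₁, cN₂, cN₃) = η(N₁, N₂, N₃)` (`c ≠ 0`). [cite: Tao2016AveragedNS, §3.3 p. 16] -/
theorem eta_mul_left (ε₀ : ℝ) {c : ℝ} (hc : c ≠ 0) (N₁ N₂ N₃ : ℝ) :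
    eta ε₀ (c * N₁) (c * N₂) (c * N₃) = eta ε₀ N₁ N₂ N₃ := by
  unfold eta
  rw [mul_div_mul_left _ _ hc, mul_div_mul_left _ _ hc]

/-- The weight of `B_{η,ρ,0}` rescaled by `(1+ε₀)^{-n}` is the weight of `B_{η,ρ,n}`. [cite: Tao2016AveragedNS, §3.4 p. 16] -/
theorem scaleWeight_zero_smul {ε₀ : ℝ} (hε : 0 < 1 + ε₀) (n : ℤ) (p : ℝ³ × ℝ³) :
    scaleWeight ε₀ 0 (((1 + ε₀) ^ n)⁻¹ • p) = scaleWeight ε₀ n p := by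
  have hc : 0 < ((1 + ε₀) ^ n)⁻¹ := inv_pos.2 (zpow_pos hε n)
  unfold scaleWeight
  simp only [Prod.smul_fst, Prod.smul_snd, neg_zero, zpow_zero, one_smul]
  rw [show -(((1 + ε₀) ^ n)⁻¹ • p.1) - ((1 + ε₀) ^ n)⁻¹ • p.2 = ((1 + ε₀) ^ n)⁻¹ • (-p.1 - p.2) by
      rw [smul_sub, smul_neg], norm_smul, norm_smul, norm_smul, Real.norm_of_nonneg hc.le,
    eta_mul_left ε₀ hc.ne', zpow_neg]

/-- The prefactor `(1+ε₀)^{-5n/2}` as the `5/2`-power of the dilation factor. [folklore] -/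
theorem scale_prefactor_eq {ε₀ : ℝ} (hε : 0 < 1 + ε₀) (n : ℤ) :
    (((1 + ε₀) ^ n)⁻¹) ^ (5 / 2 : ℝ) = (1 + ε₀) ^ (-(5 : ℝ) * (n : ℝ) / 2) := by
  rw [← zpow_neg, ← Real.rpow_intCast, ← Real.rpow_mul hε.le]
  congr 1
  push_cast
  ring

/-- **The scaling law `⟨B_{η,ρ,n}(u,v), w⟩ = ⟨B_{η,ρ,0}(Dil u, Dil v), Dil w⟩`,
`Dil = Dil_{(1+ε₀)^{-n}}`** (Tao 2016, §3.4, first display after (3.8)), for all `u, v, w ∈ L²`. [cite: Tao2016AveragedNS, §3.4 p. 16] -/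
theorem betaRhoScaleForm_eq_dil {ε₀ : ℝ} (hε : 0 < 1 + ε₀) (n : ℤ) (U V X : L2C) :
    betaRhoScaleForm ε₀ n U V X =
      betaRhoZeroForm ε₀ (dil ((1 + ε₀) ^ n)⁻¹ U) (dil ((1 + ε₀) ^ n)⁻¹ V) (dil ((1 + ε₀) ^ n)⁻¹ X) := by
  have hc : 0 < ((1 + ε₀) ^ n)⁻¹ := inv_pos.2 (zpow_pos hε n)
  rw [betaRhoZeroForm_eq_weightedForm, weightedForm_dil _ hc, betaRhoScaleForm_eq_weightedForm,
    scale_prefactor_eq hε]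
  congr 1
  unfold weightedForm
  simp_rw [scaleWeight_zero_smul hε n]

/-! ### Summing weights under absolute convergence -/

/-- **Summation of weights**: if `Σₙ |Wₙ| ≤ 1` pointwise, the `Wₙ` are measurable and the Euler
integrand of `(U,V,X)` is absolutely integrable (e.g. `U, V ∈ H¹⁰`, `X ∈ L²`), then the
`(Σₙ Wₙ)`-form is the sum of the `Wₙ`-forms (dominated convergence for series; this is
`B_{η,ρ} = -πi Σₙ (1+ε₀)^{5n/2} B_{η,ρ,n}` of §3.4 at the level of forms). [cite: Tao2016AveragedNS, §3.4 p. 16] -/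
theorem weightedForm_tsum {Wn : ℤ → ℝ³ × ℝ³ → ℝ} (hmeas : ∀ n, Measurable (Wn n))
    (hbound : ∀ p, ∑' n, ‖Wn n p‖ₑ ≤ 1) {U V X : L2C} (hint : Integrable (eulerIntegrand U V X)) :
    weightedForm (fun p => ∑' n, Wn n p) U V X = ∑' n, weightedForm (Wn n) U V X := by
  set F : ℤ → ℝ³ × ℝ³ → ℂ := fun n p => ((Wn n p : ℝ) : ℂ) * eulerIntegrand U V X p with hF
  have hFm : ∀ n, AEStronglyMeasurable (F n) volume := fun n =>
    (Complex.continuous_ofReal.measurable.comp (hmeas n)).aestronglyMeasurable.mul hint.1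
  have hF' : ∑' n, ∫⁻ p, ‖F n p‖ₑ ≠ ∞ := by
    rw [← lintegral_tsum fun n => (hFm n).aemeasurable.enorm]
    refine ne_of_lt (lt_of_le_of_lt (lintegral_mono fun p => ?_) hint.2)
    have h : ∀ n, ‖F n p‖ₑ = ‖Wn n p‖ₑ * ‖eulerIntegrand U V X p‖ₑ := fun n => by
      rw [hF, enorm_mul, enorm_eq_nnnorm ((Wn n p : ℝ) : ℂ), Complex.nnnorm_real, ← enorm_eq_nnnorm]
    simp_rw [h]
    rw [ENNReal.tsum_mul_right]
    exact mul_le_of_le_one_left zero_le (hbound p)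
  have h := integral_tsum hFm hF'
  unfold weightedForm
  rw [← h]
  refine integral_congr_ae (Eventually.of_forall fun p => ?_)
  simp only [hF]
  rw [tsum_mul_right, Complex.ofReal_tsum]

/-! ### The cascade side: `C_n` from `C₀` by dilation, and truncation in frequency -/

/-- **Pairing against a dilated (conjugated) profile is pairing the inversely dilated field**:
`⟨u, \overline{Dil_a f}⟩ = ⟨Dil_{1/a} u, \overline{f}⟩` (`a > 0`; `Dil` is unitary and real). [cite: Tao2016AveragedNS, (1.11) and (3.8)] -/
theorem pairing_conjL2_dil_eq {a : ℝ} (ha : 0 < a) (u f : L2C) :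
    pairing u (conjL2 (dil a f)) = pairing (dil a⁻¹ u) (conjL2 f) := by
  rw [conjL2_dil ha.ne', ← pairing_dil_dil ha (dil a⁻¹ u) (conjL2 f), dil_dil ha (inv_pos.2 ha),
    mul_inv_cancel₀ ha.ne', dil_one]

/-- **`⟨C_n(u,v), w⟩ = ⟨C₀(Dil u, Dil v), Dil w⟩` with `Dil = Dil_{(1+ε₀)^{-n}}`** (Tao 2016, §3.4,
second display after (3.8)): the `n`-th summand of the complexified cascade form (3.6), without its
prefactor `(1+ε₀)^{5n/2}`, is the single-scale form (3.8) of the dilated fields. [cite: Tao2016AveragedNS, §3.4 (3.8)] -/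
theorem cascadeTerm_eq_singleScaleForm_dil {ε₀ : ℝ} (hε : 0 < 1 + ε₀) (ψ₁ ψ₂ ψ₃ : 𝓢(ℝ³, ℂ³)) (n : ℤ)
    (u v w : L2C) :
    pairing u (conjL2 (cplxCascadeWavelet ε₀ ψ₁ n)) * pairing v (conjL2 (cplxCascadeWavelet ε₀ ψ₂ n)) *
        pairing w (conjL2 (cplxCascadeWavelet ε₀ ψ₃ n)) =
      singleScaleForm ψ₁ ψ₂ ψ₃ (dil ((1 + ε₀) ^ n)⁻¹ u) (dil ((1 + ε₀) ^ n)⁻¹ v)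
        (dil ((1 + ε₀) ^ n)⁻¹ w) := by
  have ha : 0 < (1 + ε₀) ^ n := zpow_pos hε n
  simp only [cplxCascadeWavelet, singleScaleForm, pairing_conjL2_dil_eq ha]

/-- **A Fourier projection equal to `1` on the band of `f` is invisible to `⟨·, f̄⟩`**:
`⟨m(D) U, f̄⟩ = ⟨U, f̄⟩` when `f̂` vanishes off `R` and `m = 1` a.e. on `R`. [folklore] -/
theorem pairing_fourierMultiplier_conjL2 {R : Set ℝ³} {f : L2C} (hf : IsBandLimited R f)
    (m : Lp ℂ ∞ (volume : Measure ℝ³)) (hm : ∀ᵐ ξ ∂(volume : Measure ℝ³), ξ ∈ R → (m : ℝ³ → ℂ) ξ = 1)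
    (U : L2C) : pairing (fourierMultiplier m U) (conjL2 f) = pairing U (conjL2 f) := by
  rw [pairing_conjL2_eq_inner, pairing_conjL2_eq_inner]
  exact hf.inner_fourierMultiplier_eq_inner m hm U

/-- A Schwartz profile with `ψ̂` supported in the closed ball `B(ξ₀, r)` is band-limited to that ball
as an `L²` class. [cite: Tao2016AveragedNS, §3.2 p. 15] -/
theorem isBandLimited_toLp_of_hasBallFourierSupport {ξ₀ : ℝ³} {r : ℝ} {ψ : 𝓢(ℝ³, ℂ³)}
    (h : HasBallFourierSupport ξ₀ r ψ) : IsBandLimited (Metric.closedBall ξ₀ r) (ψ.toLp 2) := by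
  unfold IsBandLimited fourierFn
  rw [SchwartzMap.toLp_fourier_eq]
  filter_upwards [(𝓕 ψ).coeFn_toLp 2 (μ := (volume : Measure ℝ³))] with ξ hξ hR
  rw [hξ, SchwartzMap.fourier_coe]
  exact h ξ (by simpa [Metric.mem_closedBall, not_le] using hR)

/-- **`C₀` does not see Fourier projections equal to `1` on the balls carrying the `ψ̂ⱼ`**
("From the definition of `C₀` (and the support hypotheses on `ψ₁, ψ₂, ψ₃`), we see that we may
smoothly localise each `m_{j,ω}` … without loss of generality", §3.4): if `ψ̂ⱼ ⊆ B(ξⱼ⁰, r)` and the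
symbols `mⱼ = 1` a.e. on `B(ξⱼ⁰, r)`, then `C₀(m₁(D)u, m₂(D)v, m₃(D)w) = C₀(u, v, w)`. [cite: Tao2016AveragedNS, §3.4 p. 17] -/
theorem singleScaleForm_fourierMultiplier {r : ℝ} {ψ : Fin 3 → 𝓢(ℝ³, ℂ³)}
    (hψ : ∀ j, HasBallFourierSupport (xi0 j) r (ψ j)) (m : Fin 3 → Lp ℂ ∞ (volume : Measure ℝ³))
    (hm : ∀ j, ∀ᵐ ξ ∂(volume : Measure ℝ³), ξ ∈ Metric.closedBall (xi0 j) r → (m j : ℝ³ → ℂ) ξ = 1)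
    (u v w : L2C) :
    singleScaleForm (ψ 0) (ψ 1) (ψ 2) (fourierMultiplier (m 0) u) (fourierMultiplier (m 1) v)
        (fourierMultiplier (m 2) w) =
      singleScaleForm (ψ 0) (ψ 1) (ψ 2) u v w := by
  simp only [singleScaleForm,
    pairing_fourierMultiplier_conjL2 (isBandLimited_toLp_of_hasBallFourierSupport (hψ 0)) (m 0) (hm 0),
    pairing_fourierMultiplier_conjL2 (isBandLimited_toLp_of_hasBallFourierSupport (hψ 1)) (m 1) (hm 1),
    pairing_fourierMultiplier_conjL2 (isBandLimited_toLp_of_hasBallFourierSupport (hψ 2)) (m 2) (hm 2)]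

end Literature.Analysis.FluidPDE.Tao2016
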